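import Mathlib
import Literature.NumberTheory.LFunctions.RiemannXiProofs
import Literature.NumberTheory.LFunctions.GeneralizedRH
import Literature.NumberTheory.LFunctions.LagariasXiPositivityEq14Proofs
import Summits.RiemannHypothesis.RiemannHypothesis.Theorems.DeBrangesSuzukiDoorDefs

/-!
# v6 «SuzukiWindowsDoorConverse» — L1/L2: under `ξ ≠ 0` on `Re s > 1/2`, the symbol `Θ_θ` is bounded by 1 on `ℂ₊`

RH-FREE IMPLICATIONS (nothing here bears on the truth of RH):
* `xiZeroFree_half_of_riemannHypothesis` : RH → `ξ ≠ 0` on `Re s > 1/2` (bookkeeping);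
* `norm_limTheta_le_one_of_xiZeroFree` : `ξ ≠ 0` on `Re s > 1/2` → `‖Θ_θ(z)‖ ≤ 1` for `Im z > 0`, `θ ≥ 0`
  (from the tree's `re_logDeriv_riemannXi_pos_of_offLine`, whose off-line hypothesis is vacuous here).
-/

set_option linter.dupNamespace false

open Complex

namespace Summit.RiemannHypothesis.RiemannHypothesis.Theorems.SuzukiWindowsDoorConverse

open Literature.NumberTheory.LFunctions

/-- RH-FREE bookkeeping: under `ξ ≠ 0` on `Re s > 1/2`, every zero of `ζ` in the critical strip is on the line. -/
theorem zeta_zero_re_eq_half_of_xiZeroFree (hZ : ∀ s : ℂ, 1 / 2 < s.re → riemannXi s ≠ 0)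
    {ρ : ℂ} (hζ : riemannZeta ρ = 0) (h0 : 0 < ρ.re) (h1 : ρ.re < 1) : ρ.re = 1 / 2 := by
  have hξ : riemannXi ρ = 0 := (riemannXi_eq_zero_iff_holds ρ).2 ⟨hζ, h0, h1⟩
  by_contra hne
  rcases lt_or_gt_of_ne hne with hlt | hgt
  · -- the reflected zero `1 − ρ` has real part `> 1/2`
    have h1ρ : riemannXi (1 - ρ) = 0 := (riemannXi_one_sub ρ).trans hξ
    exact hZ (1 - ρ) (by simp; linarith) h1ρ
  · exact hZ ρ hgt hξ

/-- RH-FREE bookkeeping: RH implies `ξ ≠ 0` on the open half-plane `Re s > 1/2`. -/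
theorem xiZeroFree_half_of_riemannHypothesis (hRH : RiemannHypothesis) :
    ∀ s : ℂ, 1 / 2 < s.re → riemannXi s ≠ 0 := by
  intro s hs hξ
  obtain ⟨hζ, h0, h1⟩ := (riemannXi_eq_zero_iff_holds s).1 hξ
  have hstrip := (riemannHypothesis_iff_strip_holds).1 hRH
  have : s.re = 1 / 2 := hstrip s hζ h0 h1
  linarith

/-- RH-FREE implication («inner symbol»): if `ξ ≠ 0` on `Re s > 1/2`, then `‖Θ_θ(z)‖ ≤ 1` on `Im z > 0` for `θ ≥ 0`
(indeed `Re ξ'/ξ(s) > 0` for `Re s > 1/2`). -/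
theorem norm_limTheta_le_one_of_xiZeroFree {θ : ℝ} (hθ : 0 ≤ θ)
    (hZ : ∀ s : ℂ, 1 / 2 < s.re → riemannXi s ≠ 0) {z : ℂ} (hz : 0 < z.im) :
    ‖SuzukiDoor.limTheta θ z‖ ≤ 1 := by
  unfold SuzukiDoor.limTheta
  rw [Complex.norm_exp]
  set s : ℂ := 1 / 2 - Complex.I * z with hs_def
  have hsre : 1 / 2 < s.re := by simp [hs_def]; linarith
  have hpos : 0 < (logDeriv riemannXi s).re :=
    Lagarias1999Eq14.re_logDeriv_riemannXi_pos_of_offLine hsre fun ρ hζ h0 h1 hne =>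
      absurd (zeta_zero_re_eq_half_of_xiZeroFree hZ hζ h0 h1) hne
  have hld : deriv riemannXi s / riemannXi s = logDeriv riemannXi s := by
    rw [logDeriv_apply]
  have hre : (-2 * (θ : ℂ) * (deriv riemannXi s / riemannXi s)).re = -2 * θ * (logDeriv riemannXi s).re := by
    rw [hld]
    simp [Complex.mul_re]
  rw [hre]
  have : -2 * θ * (logDeriv riemannXi s).re ≤ 0 := by nlinarith
  calc Real.exp (-2 * θ * (logDeriv riemannXi s).re) ≤ Real.exp 0 := Real.exp_le_exp.2 this
    _ = 1 := Real.exp_zero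

end Summit.RiemannHypothesis.RiemannHypothesis.Theorems.SuzukiWindowsDoorConverse
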